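import Summits.BirchSwinnertonDyer.BirchSwinnertonDyer.Theorems.KolyvaginDepthDoorDepthTableKuriharaDecisivePrime
import Summits.BirchSwinnertonDyer.BirchSwinnertonDyer.Theorems.KolyvaginDepthDoorDepthTableKuriharaSocket916c1
import Summits.BirchSwinnertonDyer.Rank1Residual.Supersingular.CountPointsFast
import HarnessLib

/-!
# Route `KolyvaginDepthDoor`, crux `KolyvaginDepthSupplyKN` (stmt-BirchSwinnertonDyer-22820) —
# DEPTH TABLE v19, ROW `916c1` @ `(5, d_K = -111)`: THE DECISIVE PRIME `ℓ★ = 311` — the row's bit ⟺ a unit mod-`5`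
# Kurihara number of the twist model `T₀ = [0, 0, 0, -49284, -1367631]` AT THE ONE PRIME `311` (kernel: `61 • P̄ ≠ O` in `T̃₀(𝔽_311)` for
# `P = (-74, 1369)`, `#T̃₀(𝔽_311) = 305 = 5·61`)

Helper file of the lead prover of line `levelone` (kdd-p1 g23; `--supports stmt-BirchSwinnertonDyer-22820
--as helper`); it closes nothing and BSD is NOT proved by it. Same template as `…KuriharaDecisive709a1`.

v18 (g22, `…KuriharaSocket916c1`) read the row EXACTLY as «bit ⟺ SOME cyclic Kolyvagin prime `ℓ` of `(T₀, 5)` carries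
a unit `δ̃_ℓ(T₀)`», and CLOSING-DATA-v18 §2b marked `ℓ = 311` with ★ (the known point `P = (-74, 1369)` of `T₀` is not
divisible by `5` in `T̃₀(𝔽_311)` — a heuristic there). v19 makes the ★ a THEOREM-LEVEL statement: by the generic
`…KuriharaDecisivePrime` (Sakamoto 2022 Lemma 4.4 + Lemma 4.6 (1) BY NAME, `hSak3`), the bit — which gives `#Sel_5(E^{(-111)}) ≤ 5`
by the row's exact reading — FORCES `δ̃_311(T₀) ≢ 0 (mod 5)`, the local `5`-indivisibility of `P` at `311` being
KERNEL-CHECKED here (`minTwist111_localNondivisible_311`: an affine double-and-add chain of 9 certified steps reaching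
`61 • P̄ = (188, 262) ≠ O` in `T̃₀(𝔽_311)` by `decide`, `5·61 = #T̃₀(𝔽_311) = 305`, and the bridge `localNondivisible_of_chainB`).
Conversely a unit at `311` closes the row by the socket. HENCE

* `twistKuriharaBit_iff_unit_311` — **bit ⟺ unit `δ̃_311(T₀)`** (for every admissible datum of `T₀`): the fleet's ONE
  residue `δ̃_311(T₀) mod 5` DECIDES the row `916c1` @ `(5, -111)` BOTH WAYS modulo print — a computed ZERO refutes the
  crux's clause at `(5, ℚ(√-111))` for `916c1` (the row then moves to another admissible prime / Heegner field), a UNIT proves it.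

Kernel lemmas: `minTwist111_card_311` (`#T̃₀(𝔽_311) = 305`, `a_311(T₀) = 7 ≡ 2 (mod 5)`), `minTwist111_isCyclicKolyvaginLevel_5_311`,
`minTwist111_localNondivisible_311`. CONDITIONAL on the named facts displayed and the E-side record claim `hδE`; per curve; nothing
class-wide; BSD is NOT proved by any of this.

References: [Sakamoto2022pSelmer] Lemma 4.4, Lemma 4.6 (1), Thm. 1.2, Thm. 1.5; [Kim2022StructureSelmer] Thm. 1.11;
[Kurihara2014] §5.3; [SilvermanAEC2009] III.2.3, VII.2.1, VII.3.1; [CremonaAlgorithms1997] Table 1 (916c1).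
-/

set_option linter.dupNamespace false

noncomputable section

open scoped Classical NumberField

namespace Summit.BirchSwinnertonDyer.BirchSwinnertonDyer.Theorems.KolyvaginDepthDoor

open Literature.NumberTheory.EllipticCurves Literature.NumberTheory.EllipticCurves.ModularForms
  WeierstrassCurve NumberField IsDedekindDomain
open Summit.BirchSwinnertonDyer.BirchSwinnertonDyer.Theorems
open Summit.BirchSwinnertonDyer.BirchSwinnertonDyer.Rank2Observatory
open Summit.BirchSwinnertonDyer.BirchSwinnertonDyer.Rank1Residual (IntModel.frobeniusTrace_eq)
open Summit.BirchSwinnertonDyer.Rank1Residual.Supersingular (natCard_point_eq_of_countPoints countPoints_eq_of_fast)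
open Summit.BirchSwinnertonDyer.Rank1Residual.Additive (card_torsion_le_of_intModel_of_card
  isKolyvaginPrime_of_intModel_of_card)

namespace C916c1

/-- `#T̃₀(𝔽_311) = 305 = 5·61` for `T₀ = [0, 0, 0, -49284, -1367631]` (`311 ≡ 1 (mod 5)`, `a_311(T₀) = 7 ≡ 2 (mod 5)`, `5² ∤ 305`),
kernel-decided (`countPointsFast`). [cite: Kim2022StructureSelmer, §1.2.2 (PDF p. 5)] -/
theorem minTwist111_card_311 :
    Nat.card (((⟨0, 0, 0, -49284, -1367631⟩ : WeierstrassCurve ℤ).map (Int.castRingHom (ZMod 311))).toAffine.Point) = 305 :=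
  haveI : Fact (Nat.Prime 311) := ⟨by norm_num⟩
  natCard_point_eq_of_countPoints 0 0 0 (-49284) (-1367631) 311 (by norm_num) (by decide +kernel) (n := 305)
    (countPoints_eq_of_fast (by decide +kernel))

/-- **`311` is a CYCLIC KOLYVAGIN PRIME for `(T₀, 5)`** (`311 ∤ 5·N_{T₀}`, `311 ≡ 1`, `a_311(T₀) ≡ 2 (mod 5)`,
`#T̃₀(𝔽_311)[5] ≤ 5`) — a ★ candidate of CLOSING-DATA-v18 §2b. [cite: Kim2022StructureSelmer, §1.2.2 (PDF p. 5)] -/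
theorem minTwist111_isCyclicKolyvaginLevel_5_311 :
    haveI := minTwist111_isGloballyMinimal; haveI := Fact.mk (by norm_num : Nat.Prime 5);
    IsCyclicKolyvaginLevel ((⟨0, 0, 0, -49284, -1367631⟩ : WeierstrassCurve ℤ).map (Int.castRingHom ℚ)) 5 311 := by
  haveI := minTwist111_isElliptic
  haveI := minTwist111_isGloballyMinimal
  haveI := Fact.mk (by norm_num : Nat.Prime 5)
  haveI : Fact (Nat.Prime 311) := ⟨by norm_num⟩
  have hℓ : Kato.IsKolyvaginPrime ((⟨0, 0, 0, -49284, -1367631⟩ : WeierstrassCurve ℤ).map (Int.castRingHom ℚ)) 5 1 311 :=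
    isKolyvaginPrime_of_intModel_of_card minTwist111_intModel 5 1 311 (by norm_num) (by decide +kernel) (by decide)
      minTwist111_card_311 (by norm_num)
  refine ⟨⟨Nat.squarefree_iff_nodup_primeFactorsList (by norm_num) |>.mpr (by simp), fun ℓ hℓ' ↦ ?_⟩, fun ℓ hℓ' hdvd ↦ ?_⟩
  · rw [show (311 : ℕ).primeFactors = {311} from (Nat.Prime.primeFactors (by norm_num)), Finset.mem_singleton] at hℓ'
    exact hℓ' ▸ hℓ
  · obtain rfl := (Nat.prime_dvd_prime_iff_eq hℓ'.out (by norm_num)).mp hdvd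
    exact card_torsion_le_of_intModel_of_card minTwist111_intModel 5 311 minTwist111_card_311 (by norm_num)

/-- The rational point `P = (-74, 1369)` of `T₀ = [0, 0, 0, -49284, -1367631]` (integral; on the curve). [folklore] -/
theorem minTwist111_nonsingular_P :
    ((⟨0, 0, 0, -49284, -1367631⟩ : WeierstrassCurve ℤ).map (Int.castRingHom ℚ)).toAffine.Nonsingular ((-74 : ℤ) : ℚ) ((1369 : ℤ) : ℚ) :=
  nonsingular_rat_of_eq _ (by decide +kernel) (by norm_num)

/-- The double-and-add chain from `P̄` reaches the multiplier `61`. [folklore] -/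
theorem chain311_mult :
    chainMult 1 [(true, ((292 : ℤ) : ZMod 311), ((224 : ℤ) : ZMod 311)), (false, ((146 : ℤ) : ZMod 311), ((101 : ℤ) : ZMod 311)), (true, ((59 : ℤ) : ZMod 311), ((7 : ℤ) : ZMod 311)), (false, ((156 : ℤ) : ZMod 311), ((51 : ℤ) : ZMod 311)), (true, ((162 : ℤ) : ZMod 311), ((17 : ℤ) : ZMod 311)), (false, ((33 : ℤ) : ZMod 311), ((119 : ℤ) : ZMod 311)), (true, ((122 : ℤ) : ZMod 311), ((35 : ℤ) : ZMod 311)), (true, ((245 : ℤ) : ZMod 311), ((258 : ℤ) : ZMod 311)), (false, ((188 : ℤ) : ZMod 311), ((262 : ℤ) : ZMod 311))] = 61 := by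
  decide

/-- The double-and-add chain from `P̄ = (-74, 1369)` to `61 • P̄ = (188, 262)` in `T̃₀(𝔽_311)` CHECKS (tangent / chord
certificates, `decide`). [cite: SilvermanAEC2009, III.2.3] -/
theorem chain311_ok :
    chainB (⟨0, 0, 0, -49284, -1367631⟩ : WeierstrassCurve ℤ) 311 (((-74 : ℤ)) : ZMod 311) (((1369 : ℤ)) : ZMod 311)
      ((((-74 : ℤ)) : ZMod 311), (((1369 : ℤ)) : ZMod 311))
      [(true, ((292 : ℤ) : ZMod 311), ((224 : ℤ) : ZMod 311)), (false, ((146 : ℤ) : ZMod 311), ((101 : ℤ) : ZMod 311)), (true, ((59 : ℤ) : ZMod 311), ((7 : ℤ) : ZMod 311)), (false, ((156 : ℤ) : ZMod 311), ((51 : ℤ) : ZMod 311)), (true, ((162 : ℤ) : ZMod 311), ((17 : ℤ) : ZMod 311)), (false, ((33 : ℤ) : ZMod 311), ((119 : ℤ) : ZMod 311)), (true, ((122 : ℤ) : ZMod 311), ((35 : ℤ) : ZMod 311)), (true, ((245 : ℤ) : ZMod 311), ((258 : ℤ) : ZMod 311)), (false, ((188 : ℤ) : ZMod 311), ((262 :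 ℤ) : ZMod 311))] = true := by
  decide +kernel

/-- **KERNEL: `P = (-74, 1369)` is not divisible by `5` in `T₀(ℚ_311)`** — the chain certifies `61 • P̄ ≠ O` in `T̃₀(𝔽_311)`,
`5·61 = #T̃₀(𝔽_311)`, and `localNondivisible_of_chainB`. This is the ★ of CLOSING-DATA-v18 §2b for `916c1` at `311`, now in
the kernel. [cite: SilvermanAEC2009, III.2.3, VII.2 Prop. 2.1, VII.3 Prop. 3.1] -/
theorem minTwist111_localNondivisible_311 :
    haveI : Fact (Nat.Prime 311) := ⟨by norm_num⟩;
    ∀ Q : (((⟨0, 0, 0, -49284, -1367631⟩ : WeierstrassCurve ℤ).map (Int.castRingHom ℚ)).baseChange ℚ_[311]).toAffine.Point,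
      5 • Q ≠ WeierstrassCurve.Affine.Point.map (W' := ((⟨0, 0, 0, -49284, -1367631⟩ : WeierstrassCurve ℤ).map (Int.castRingHom ℚ)).toAffine)
        (S := ℚ) (Algebra.ofId ℚ ℚ_[311]) (.some ((-74 : ℤ) : ℚ) ((1369 : ℤ) : ℚ) minTwist111_nonsingular_P) := by
  haveI : Fact (Nat.Prime 311) := ⟨by norm_num⟩
  have hq : ¬ ((311 : ℕ) : ℤ) ∣ (⟨0, 0, 0, -49284, -1367631⟩ : WeierstrassCurve ℤ).Δ := by decide +kernel
  have hXY : (⟨0, 0, 0, -49284, -1367631⟩ : WeierstrassCurve ℤ).toAffine.Equation (-74) (1369) :=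
    (Affine.equation_iff _ _).mpr (by norm_num)
  have hpk : 5 * 61 = Nat.card (((⟨0, 0, 0, -49284, -1367631⟩ : WeierstrassCurve ℤ).map (Int.castRingHom (ZMod 311))).toAffine.Point) := by
    rw [minTwist111_card_311]
  exact localNondivisible_of_chainB (⟨0, 0, 0, -49284, -1367631⟩ : WeierstrassCurve ℤ) 311 hq hXY minTwist111_nonsingular_P hpk
    chain311_mult (by convert chain311_ok)

/-- **ROW `916c1` @ `(5, -111)`: THE DECISIVE PRIME `311` — bit ⟺ unit `δ̃_311(T₀)`.** For every imaginary quadratic `K`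
with `d_K = -111`, granted the named facts displayed and the E-side record claim `hδE`: «some frame, some Kolyvagin PRIME
`ℓ`, some Kolyvagin–Heegner datum of conductor `ℓ` with `c_1(ℓ) ≠ 0`» (the depth-table bit) holds IF AND ONLY IF «every
datum `D` of `T₀` at level `N_{T₀}` with `5 ∤ c_D` and the period transfer has a UNIT mod-`5` Kurihara number AT `311`» —
the claim of a future tree record `cert_<T₀>` @ `(5, 311)`. (⟹): bit ⟹ `#Sel_5(E^{(-111)}) ≤ 5` (the socket's exact reading
∘ v18's twist IFF) ⟹ unit at `311` (`twistKuriharaClaim_prime_of_natCard_selmerGroup_le` with the kernel certificate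
`minTwist111_localNondivisible_311`); (⟸): the exact reading with `m = 311` (`minTwist111_isCyclicKolyvaginLevel_5_311`, `ν(311) = 1`).
CONDITIONAL on the named facts and the claim; per curve; BSD is not proved by it.
[cite: Sakamoto2022pSelmer, Lemma 4.4, Lemma 4.6 (1), Thm. 1.2, Thm. 1.5] [cite: Kim2022StructureSelmer, Thm. 1.11]
[cite: CremonaAlgorithms1997, Table 1 (916c1)] -/
theorem twistKuriharaBit_iff_unit_311
    (h372 : GrossLMS1991.prop37_2_frobeniusCongruence)
    (h3 : Literature.NumberTheory.EllipticCurves.CastellaSano2026_kolyvaginClass_selmerDivisibility_eq_padicValNat_tamagawaProduct)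
    (hZ : Literature.NumberTheory.EllipticCurves.Zanarella2019_kolyvaginClass_one_ne_zero_of_not_selmerDivisible)
    (hHZ : Literature.NumberTheory.EllipticCurves.HowardZanarella_exists_minimal_kolyvaginClass_one_selmerCard_of_ne_zero)
    (hKim : Kim2022_card_selmerGroup_le_pow_of_kuriharaNumber_ne_zero)
    (hSak1 : Sakamoto2022_card_selmerGroup_eq_pow_of_isDeltaMinimal)
    (hSak2 : Sakamoto2022_exists_cyclicLevel_kuriharaNumber_ne_zero)
    (hSak3 : Literature.NumberTheory.EllipticCurves.Sakamoto2022_kuriharaNumber_prime_ne_zero_of_localNondivisible)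
    (hnf : exists_isNewformOf) (hMaz : mazur_not_dvd_maninConstant_of_odd)
    (K : Type) [Field K] [NumberField K] (hK : IsImaginaryQuadratic K) (hD : NumberField.discr K = -111)
    (hδE : haveI := isElliptic_c916c1; haveI := isGloballyMinimal_c916c1;
      haveI : NeZero (((⟨0, 0, 0, -4, 1⟩ : WeierstrassCurve ℤ).map (Int.castRingHom ℚ)).conductorNorm ℤ) := neZero_conductorNorm_of_isElliptic _;
      haveI := Fact.mk (by norm_num : Nat.Prime 5);
      ∀ (D : ModularParametrizationData ((⟨0, 0, 0, -4, 1⟩ : WeierstrassCurve ℤ).map (Int.castRingHom ℚ)) (((⟨0, 0, 0, -4, 1⟩ : WeierstrassCurve ℤ).map (Int.castRingHom ℚ)).conductorNorm ℤ)), ¬ ((5 : ℕ) : ℤ) ∣ D.maninConstant →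
        (∃ u : ℚ, ‖(u : ℚ_[5])‖ = 1 ∧ ((⟨0, 0, 0, -4, 1⟩ : WeierstrassCurve ℤ).map (Int.castRingHom ℚ)).realPeriodRat = u * plusPeriod D.f) →
        ∃ ψ : (ℓ : ℕ) → (ZMod ℓ)ˣ →* Multiplicative (ZMod 5),
          (∀ ℓ ∈ (341 : ℕ).primeFactors, Function.Surjective (ψ ℓ)) ∧ kuriharaNumber D.f 5 341 ψ ≠ 0) :
    haveI := isElliptic_c916c1; haveI := isGloballyMinimal_c916c1;
    haveI : NeZero (((⟨0, 0, 0, -4, 1⟩ : WeierstrassCurve ℤ).map (Int.castRingHom ℚ)).conductorNorm ℤ) := neZero_conductorNorm_of_isElliptic _;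
    haveI := minTwist111_isElliptic; haveI := minTwist111_isGloballyMinimal;
    haveI : NeZero (((⟨0, 0, 0, -49284, -1367631⟩ : WeierstrassCurve ℤ).map (Int.castRingHom ℚ)).conductorNorm ℤ) := neZero_conductorNorm_of_isElliptic _;
    haveI := Fact.mk (by norm_num : Nat.Prime 5);
    (∃ (Dt : ModularParametrizationData ((⟨0, 0, 0, -4, 1⟩ : WeierstrassCurve ℤ).map (Int.castRingHom ℚ)) (((⟨0, 0, 0, -4, 1⟩ : WeierstrassCurve ℤ).map (Int.castRingHom ℚ)).conductorNorm ℤ)) (β : ℤ)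
      (ι : K →+* ℂ) (ℓ : ℕ) (d : KolyvaginHeegnerData Dt β ι ℓ),
      ℓ.Prime ∧ Zhang2014.IsKolyvaginPrime (((⟨0, 0, 0, -4, 1⟩ : WeierstrassCurve ℤ).map (Int.castRingHom ℚ)).conductorNorm ℤ) ((⟨0, 0, 0, -4, 1⟩ : WeierstrassCurve ℤ).map (Int.castRingHom ℚ)) K 5 ℓ ∧
        d.kolyvaginClass (p := 5) (by norm_num) 1 ≠ 0) ↔
    (∀ (D : ModularParametrizationData ((⟨0, 0, 0, -49284, -1367631⟩ : WeierstrassCurve ℤ).map (Int.castRingHom ℚ))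
          (((⟨0, 0, 0, -49284, -1367631⟩ : WeierstrassCurve ℤ).map (Int.castRingHom ℚ)).conductorNorm ℤ)),
        ¬ ((5 : ℕ) : ℤ) ∣ D.maninConstant →
        (∃ u : ℚ, ‖(u : ℚ_[5])‖ = 1 ∧
          ((⟨0, 0, 0, -49284, -1367631⟩ : WeierstrassCurve ℤ).map (Int.castRingHom ℚ)).realPeriodRat = u * plusPeriod D.f) →
        ∃ ψ : (q : ℕ) → (ZMod q)ˣ →* Multiplicative (ZMod 5),
          (∀ q ∈ (311 : ℕ).primeFactors, Function.Surjective (ψ q)) ∧ kuriharaNumber D.f 5 311 ψ ≠ 0) := by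
  haveI := isElliptic_c916c1
  haveI := isGloballyMinimal_c916c1
  haveI iNZ : NeZero (((⟨0, 0, 0, -4, 1⟩ : WeierstrassCurve ℤ).map (Int.castRingHom ℚ)).conductorNorm ℤ) :=
    neZero_conductorNorm_of_isElliptic _
  haveI := minTwist111_isElliptic
  haveI := minTwist111_isGloballyMinimal
  haveI iNZT : NeZero (((⟨0, 0, 0, -49284, -1367631⟩ : WeierstrassCurve ℤ).map (Int.castRingHom ℚ)).conductorNorm ℤ) :=
    neZero_conductorNorm_of_isElliptic _
  haveI iP := Fact.mk (by norm_num : Nat.Prime 5)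
  haveI : Fact (Nat.Prime 311) := ⟨by norm_num⟩
  haveI : NeZero (311 : ℕ) := ⟨by norm_num⟩
  have hsur : ((⟨0, 0, 0, -4, 1⟩ : WeierstrassCurve ℤ).map (Int.castRingHom ℚ)).HasSurjectiveModNGaloisRep ((5 : ℕ) : ℤ) := by
    simpa using hasSurjectiveModNGaloisRep_pow_5 1
  have hC : (⟨1, (0 : ℚ), (0 : ℚ), (0 : ℚ)⟩ : WeierstrassCurve.VariableChange ℚ) •
      ((⟨0, 0, 0, -49284, -1367631⟩ : WeierstrassCurve ℤ).map (Int.castRingHom ℚ)) =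
      ((⟨0, 0, 0, -4, 1⟩ : WeierstrassCurve ℤ).map (Int.castRingHom ℚ)).quadraticTwist ((NumberField.discr K : ℤ) : ℚ) := by
    rw [hD]; push_cast; exact minTwist111_smul_eq
  have hpD : ¬ (((5 : ℕ) : ℤ) ∣ NumberField.discr K) := by rw [hD]; decide
  have hiff := kolyvaginPrime_iff_twistKuriharaBit_5_neg111 h372 h3 hZ hHZ hKim hSak1 hSak2 hnf hMaz K hK hD hδE
  constructor
  · intro hbit D hc hu
    have hT := (natCard_selmerGroup_quadraticTwist_le_iff_kuriharaBit hKim hSak1 hSak2 hnf hMaz _ 5 le_rfl goodOrdinary_5.1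
      goodOrdinary_5.2 hsur (NumberField.discr_ne_zero K) hpD _ _ hC minTwist111_nonAnomalous_5 minTwist111_kodairaNeron_5 1).mpr (hiff.mp hbit)
    rw [pow_one] at hT
    exact twistKuriharaClaim_prime_of_natCard_selmerGroup_le hSak3 _ 5 le_rfl goodOrdinary_5.1 goodOrdinary_5.2 hsur
      (NumberField.discr_ne_zero K) hpD _ _ hC minTwist111_nonAnomalous_5 minTwist111_kodairaNeron_5 hT 311
      minTwist111_isCyclicKolyvaginLevel_5_311 _ minTwist111_localNondivisible_311 D hc hu
  · intro hunit
    refine hiff.mpr fun D hc hu ↦ ?_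
    obtain ⟨ψ, hψ, hne⟩ := hunit D hc hu
    refine ⟨311, inferInstance, minTwist111_isCyclicKolyvaginLevel_5_311, ?_, ψ, hψ, hne⟩
    rw [Nat.Prime.primeFactors (by norm_num), Finset.card_singleton]

end C916c1

end Summit.BirchSwinnertonDyer.BirchSwinnertonDyer.Theorems.KolyvaginDepthDoor

end
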